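import Summits.AtomisticToContinuum.BoseEinsteinCondensation.Theorems.BECGroundStateSOSPeriodicIRBoundFsumDCAdjoint
import Summits.AtomisticToContinuum.BoseEinsteinCondensation.Theorems.BECGroundStateSOSPeriodicIRBoundFsumExcitedPairs
import Summits.AtomisticToContinuum.BoseEinsteinCondensation.Theorems.BECGroundStateSOSPeriodicIRBoundFsumConePhaseUp
import Summits.AtomisticToContinuum.BoseEinsteinCondensation.Theorems.BECGroundStateSOSPeriodicIRBoundFsumDichotomy
import Literature.MathematicalPhysics.QuantumManyBody.TorusFockLayer
import HarnessLib

/-!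
# Crux `RichardsonAnchorBEC` (stmt-AtomisticToContinuum-14805), route `BECRichardsonGaudin`, line `registered` —
# stub `stub_crossTermLower`: the completed-square bound on the pair-exchange cross term

First-quantised Bogoliubov-type inequality controlling the pair-exchange term `a₀†a₀†a_{-k}a_k + h.c.` of the
Richardson pairing anchor for ONE band mode `k ≠ 0` on the `(n+2)`-particle sector (`n ≥ 1`). With the
trial function `Ψ`, `u := a_k Ψ`, `Φ₀ := a₀ a₀ Ψ`, `h := a_{-k}† Φ₀` and `X := Re⟨Φ₀, a_{-k} a_k Ψ⟩`, for
`ε > 0` and real `w`: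

`-2 w X ≤ ε ‖a_k Ψ‖² + (w² / ε) ((n+2)² ‖a_{-k} Ψ‖² + ‖Φ₀‖²)`,

stated in `ℝ≥0∞` through `ENNReal.ofReal` of the left side (`stub_crossTermLower`). Paper proof and tree
lemmas:
1. `0 ≤ ‖u + (w/ε) h‖² = ‖u‖² + 2 (w/ε) Re⟨u, h⟩ + (w/ε)² ‖h‖²` (`WF.normSq_add_smul`), times `ε`;
2. adjointness `Re⟨u, a_{-k}† Φ₀⟩ = Re⟨Φ₀, a_{-k} u⟩ = X` (`WF.integral_conj_modeAn_planeWaveMode_mul`,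
   `innerRe_comm`) — `innerRe_modeCr_right`;
3. `‖a_{-k}† Φ₀‖² = ‖Φ₀‖² + ‖a_{-k} Φ₀‖²` (`WF.normSq_modeCr`, `WF.normSq_modeAn`);
4. `a_{-k} a₀ a₀ Ψ = a₀ a₀ a_{-k} Ψ` (`WF.modeAn_modeAn_planeWaveMode_comm`) and `‖a₀ g‖² ≤ N ‖g‖²` for
   `N`-body `g` (`normSq_modeAn_le`) twice: `‖a_{-k} Φ₀‖² ≤ n (n+1) ‖a_{-k} Ψ‖² ≤ (n+2)² ‖a_{-k} Ψ‖²`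
   (`normSq_modeAn_modeAn_modeAn_le`);
5. the real inequality (`crossTerm_real_le`) is moved to `ℝ≥0∞` (all norms are finite, `WF.normSq_ne_top`).
-/

noncomputable section

open MeasureTheory Filter
open scoped ENNReal NNReal ComplexConjugate BigOperators

namespace Summit.AtomisticToContinuum.BoseEinsteinCondensation.Cruxes.RichardsonAnchorBEC.Birth

open Literature.MathematicalPhysics.QuantumManyBody.BoseGas
open Summit.AtomisticToContinuum.BoseEinsteinCondensation.Cruxes.PeriodicIRBound.LinearPhFloorWagner.WF

open Summit.AtomisticToContinuum.BoseEinsteinCondensation.Cruxes.PeriodicIRBound.FsumPhasePencil in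
/-- Adjointness in real-pairing form: `Re⟨Ψ, a_p† Φ⟩ = Re⟨Φ, a_p Ψ⟩` for a continuous `n`-body `Φ` and a
continuous Bose-symmetric `(n+1)`-body `Ψ`. [folklore] -/
theorem innerRe_modeCr_right {L : ℝ} (p : Fin 3 → ℤ) {n : ℕ} {Φ : Config n → ℂ} (hΦ : Continuous Φ)
    {Ψ : Config (n + 1) → ℂ} (hΨ : Continuous Ψ) (hsymm : IsSymm Ψ) :
    innerRe L Ψ (modeCr (planeWaveMode L p) Φ) = innerRe L Φ (modeAn L (planeWaveMode L p) Ψ) := by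
  have h : innerRe L (modeAn L (planeWaveMode L p) Ψ) Φ = innerRe L Ψ (modeCr (planeWaveMode L p) Φ) := by
    unfold innerRe
    rw [integral_conj_modeAn_planeWaveMode_mul p hΦ hΨ hsymm]
  rw [← h, innerRe_comm]

open Summit.AtomisticToContinuum.BoseEinsteinCondensation.Cruxes.PeriodicIRBound.FsumPhasePencil in
/-- `‖a_q a₀ a₀ Ψ‖² ≤ (m+1)(m+2) ‖a_q Ψ‖²` for a core `(m+3)`-body `Ψ`: commute `a_q` to the inside
(`[a_q, a₀] = 0` on continuous Bose-symmetric functions), then `‖a₀ g‖² ≤ N ‖g‖²` twice. [folklore] -/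
theorem normSq_modeAn_modeAn_modeAn_le {L : ℝ} (hL : 0 < L) (q : Fin 3 → ℤ) {m : ℕ}
    {Ψ : Config (m + 1 + 2) → ℂ} (hΨ : IsCore L Ψ) :
    normSq L (modeAn L (planeWaveMode L q) (modeAn L (planeWaveMode L 0) (modeAn L (planeWaveMode L 0) Ψ))) ≤
      (((m + 1) * (m + 2) : ℕ) : ℝ≥0∞) * normSq L (modeAn L (planeWaveMode L q) Ψ) := by
  have hΨc : Continuous Ψ := hΨ.contDiff.continuous
  have h0 : IsCore L (modeAn L (planeWaveMode L 0) Ψ) := isCore_modeAn hL 0 hΨ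
  have hq : IsCore L (modeAn L (planeWaveMode L q) Ψ) := isCore_modeAn hL q hΨ
  have hq0 : IsCore L (modeAn L (planeWaveMode L 0) (modeAn L (planeWaveMode L q) Ψ)) := isCore_modeAn hL 0 hq
  -- commute `a_q` to the inside
  have hcomm : modeAn L (planeWaveMode L q) (modeAn L (planeWaveMode L 0) (modeAn L (planeWaveMode L 0) Ψ)) =
      modeAn L (planeWaveMode L 0) (modeAn L (planeWaveMode L 0) (modeAn L (planeWaveMode L q) Ψ)) := by
    rw [modeAn_modeAn_planeWaveMode_comm q 0 h0.contDiff.continuous h0.symm,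
      modeAn_modeAn_planeWaveMode_comm q 0 hΨc hΨ.symm]
  rw [hcomm]
  have h1 : normSq L (modeAn L (planeWaveMode L 0) (modeAn L (planeWaveMode L 0) (modeAn L (planeWaveMode L q) Ψ))) ≤
      (m + 1 : ℝ≥0∞) * normSq L (modeAn L (planeWaveMode L 0) (modeAn L (planeWaveMode L q) Ψ)) :=
    normSq_modeAn_le hL 0 hq0.contDiff.continuous
  have h2 : normSq L (modeAn L (planeWaveMode L 0) (modeAn L (planeWaveMode L q) Ψ)) ≤
      (m + 1 + 1 : ℝ≥0∞) * normSq L (modeAn L (planeWaveMode L q) Ψ) := by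
    have h := normSq_modeAn_le hL 0 hq.contDiff.continuous
    push_cast at h
    exact h
  calc normSq L (modeAn L (planeWaveMode L 0) (modeAn L (planeWaveMode L 0) (modeAn L (planeWaveMode L q) Ψ)))
      ≤ (m + 1 : ℝ≥0∞) * ((m + 1 + 1 : ℝ≥0∞) * normSq L (modeAn L (planeWaveMode L q) Ψ)) :=
        h1.trans (by gcongr)
    _ = (((m + 1) * (m + 2) : ℕ) : ℝ≥0∞) * normSq L (modeAn L (planeWaveMode L q) Ψ) := by
        push_cast
        ring

/-- The cross-term inequality in `ℝ`: for a core `(m+3)`-body `Ψ`, `ε > 0`, real `w` and any mode `k`,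
`-2 w Re⟨a₀a₀Ψ, a_{-k} a_k Ψ⟩ ≤ ε ‖a_k Ψ‖² + (w²/ε) ((m+3)² ‖a_{-k} Ψ‖² + ‖a₀ a₀ Ψ‖²)`
(completed square `‖√ε a_kΨ + (w/√ε) a_{-k}† a₀a₀Ψ‖² ≥ 0`, adjointness, `‖a†g‖² = ‖g‖² + ‖a g‖²`,
`‖a g‖² ≤ N‖g‖²`). [folklore] -/
theorem crossTerm_real_le {L ε : ℝ} (hL : 0 < L) (hε : 0 < ε) (w : ℝ) (k : Fin 3 → ℤ) {m : ℕ}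
    {Ψ : Config (m + 1 + 2) → ℂ} (hΨ : IsCore L Ψ) :
    -(2 * w * innerRe L (modeAn L (planeWaveMode L 0) (modeAn L (planeWaveMode L 0) Ψ))
        (modeAn L (planeWaveMode L (-k)) (modeAn L (planeWaveMode L k) Ψ))) ≤
      ε * (normSq L (modeAn L (planeWaveMode L k) Ψ)).toReal +
        w ^ 2 / ε * (((m + 1 + 2 : ℕ) : ℝ) ^ 2 * (normSq L (modeAn L (planeWaveMode L (-k)) Ψ)).toReal +
          (normSq L (modeAn L (planeWaveMode L 0) (modeAn L (planeWaveMode L 0) Ψ))).toReal) := by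
  -- names: `u = a_k Ψ`, `v = a_{-k} Ψ`, `Φ₀ = a₀ a₀ Ψ`, `h = a_{-k}† Φ₀`
  set u := modeAn L (planeWaveMode L k) Ψ
  set v := modeAn L (planeWaveMode L (-k)) Ψ
  set Φ₀ := modeAn L (planeWaveMode L 0) (modeAn L (planeWaveMode L 0) Ψ)
  -- regularity and finiteness
  have hucore : IsCore L u := isCore_modeAn hL k hΨ
  have hΦ₀core : IsCore L Φ₀ := isCore_modeAn hL 0 (isCore_modeAn hL 0 hΨ)
  have huc : Continuous u := hucore.contDiff.continuous
  have hvc : Continuous v := (isCore_modeAn hL (-k) hΨ).contDiff.continuous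
  have hΦ₀c : Continuous Φ₀ := hΦ₀core.contDiff.continuous
  have hhc : Continuous (modeCr (planeWaveMode L (-k)) Φ₀) :=
    (isCore_modeCr hL (-k) hΦ₀core).contDiff.continuous
  have hvt : normSq L v ≠ ⊤ := normSq_ne_top L hvc
  have hΦ₀t : normSq L Φ₀ ≠ ⊤ := normSq_ne_top L hΦ₀c
  have hat : normSq L (modeAn L (planeWaveMode L (-k)) Φ₀) ≠ ⊤ :=
    normSq_ne_top L (isCore_modeAn hL (-k) hΦ₀core).contDiff.continuous
  -- Step 2: adjointness `Re⟨u, a_{-k}† Φ₀⟩ = Re⟨Φ₀, a_{-k} u⟩`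
  have hX : innerRe L u (modeCr (planeWaveMode L (-k)) Φ₀) =
      innerRe L Φ₀ (modeAn L (planeWaveMode L (-k)) u) :=
    innerRe_modeCr_right (-k) hΦ₀c huc hucore.symm
  -- Step 1: the completed square `0 ≤ ‖u + (w/ε) h‖²`, times `ε`
  have h1 : -(2 * w * innerRe L u (modeCr (planeWaveMode L (-k)) Φ₀)) ≤
      ε * (normSq L u).toReal + w ^ 2 / ε * (normSq L (modeCr (planeWaveMode L (-k)) Φ₀)).toReal := by
    have hnn : 0 ≤ (normSq L (fun X => u X + ((w / ε : ℝ) : ℂ) * modeCr (planeWaveMode L (-k)) Φ₀ X)).toReal :=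
      ENNReal.toReal_nonneg
    rw [normSq_add_smul hL huc hhc (w / ε)] at hnn
    have key : ε * ((normSq L u).toReal + 2 * (w / ε) * innerRe L u (modeCr (planeWaveMode L (-k)) Φ₀) +
          (w / ε) ^ 2 * (normSq L (modeCr (planeWaveMode L (-k)) Φ₀)).toReal) =
        ε * (normSq L u).toReal + 2 * w * innerRe L u (modeCr (planeWaveMode L (-k)) Φ₀) +
          w ^ 2 / ε * (normSq L (modeCr (planeWaveMode L (-k)) Φ₀)).toReal := by
      field_simp
    have h := mul_nonneg hε.le hnn
    rw [key] at h
    linarith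
  -- Step 3: `‖a_{-k}† Φ₀‖² = ‖Φ₀‖² + ‖a_{-k} Φ₀‖²`
  have h3 : normSq L (modeCr (planeWaveMode L (-k)) Φ₀) =
      normSq L Φ₀ + normSq L (modeAn L (planeWaveMode L (-k)) Φ₀) := by
    rw [normSq_modeCr hL (-k) hΦ₀core, ← normSq_modeAn hL (-k) Φ₀]
  -- Step 4: `‖a_{-k} Φ₀‖² ≤ (m+1)(m+2) ‖v‖² ≤ (m+3)² ‖v‖²`
  have h4 : normSq L (modeAn L (planeWaveMode L (-k)) Φ₀) ≤ ((m + 1 + 2 : ℕ) : ℝ≥0∞) ^ 2 * normSq L v := by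
    refine (normSq_modeAn_modeAn_modeAn_le hL (-k) hΨ).trans ?_
    gcongr
    exact_mod_cast (show (m + 1) * (m + 2) ≤ (m + 1 + 2) ^ 2 by nlinarith)
  have h4' : (normSq L (modeAn L (planeWaveMode L (-k)) Φ₀)).toReal ≤
      ((m + 1 + 2 : ℕ) : ℝ) ^ 2 * (normSq L v).toReal := by
    have h := ENNReal.toReal_mono (ENNReal.mul_ne_top (ENNReal.pow_ne_top (ENNReal.natCast_ne_top _)) hvt) h4
    rwa [ENNReal.toReal_mul, ENNReal.toReal_pow, ENNReal.toReal_natCast] at h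
  -- Step 5: combine
  have hh' : (normSq L (modeCr (planeWaveMode L (-k)) Φ₀)).toReal ≤
      ((m + 1 + 2 : ℕ) : ℝ) ^ 2 * (normSq L v).toReal + (normSq L Φ₀).toReal := by
    rw [h3, ENNReal.toReal_add hΦ₀t hat]
    linarith
  have hwε : 0 ≤ w ^ 2 / ε := by positivity
  rw [← hX]
  linarith [mul_le_mul_of_nonneg_left hh' hwε]

/-- **Cross-term lower bound** (stub `stub_crossTermLower` of the registered line of crux
`RichardsonAnchorBEC`): for `L, ε > 0`, real `w`, `n ≥ 1`, a band mode `k ≠ 0` and an `(n+2)`-body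
periodic trial state `Φ` (`Ψ = Φ.ψ`),
`ENNReal.ofReal (-2 w Re⟨a₀a₀Ψ, a_{-k} a_k Ψ⟩) ≤ ε ‖a_k Ψ‖² + (w²/ε) ((n+2)² ‖a_{-k} Ψ‖² + ‖a₀ a₀ Ψ‖²)`:
the expectation of the operator inequality `w (a₀†a₀†a_{-k}a_k + h.c.) ≥ -ε n_k - (w²/ε)(n_{-k} + 1) a₀†²a₀²`
(completed square `C†C ≥ 0`, `C = √ε a_k + (w/√ε) a_{-k}† a₀²`) together with `a₀†²a₀² (n_{-k} + 1) ≤ N² n_{-k} + a₀†²a₀²`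
in expectation (`‖a_{-k} a₀² Ψ‖² ≤ n(n+1) ‖a_{-k}Ψ‖²`). [folklore] -/
theorem stub_crossTermLower :
    ∀ (L ε w : ℝ) (n : ℕ) (k : Momentum), 0 < L → 0 < ε → k ≠ 0 → 1 ≤ n → ∀ Φ : PeriodicTrialState (n + 2) L,
      ENNReal.ofReal (-(2 * w *
          innerRe L (modeAn L (planeWaveMode L 0) (modeAn L (planeWaveMode L 0) Φ.ψ))
            (modeAn L (planeWaveMode L (-k)) (modeAn L (planeWaveMode L k) Φ.ψ)))) ≤
        ENNReal.ofReal ε * normSq L (modeAn L (planeWaveMode L k) Φ.ψ) +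
          ENNReal.ofReal (w ^ 2 / ε) *
            (((n + 2 : ℕ) : ℝ≥0∞) ^ 2 * normSq L (modeAn L (planeWaveMode L (-k)) Φ.ψ) +
              normSq L (modeAn L (planeWaveMode L 0) (modeAn L (planeWaveMode L 0) Φ.ψ))) := by
  intro L ε w n k hL hε _hk hn Φ
  obtain ⟨m, rfl⟩ : ∃ m, n = m + 1 := ⟨n - 1, by omega⟩
  have hΨ : IsCore L Φ.ψ := isCore_trialState Φ
  -- finiteness of the three norms on the right
  have hut : normSq L (modeAn L (planeWaveMode L k) Φ.ψ) ≠ ⊤ :=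
    normSq_ne_top L (isCore_modeAn hL k hΨ).contDiff.continuous
  have hvt : normSq L (modeAn L (planeWaveMode L (-k)) Φ.ψ) ≠ ⊤ :=
    normSq_ne_top L (isCore_modeAn hL (-k) hΨ).contDiff.continuous
  have hΦ₀t : normSq L (modeAn L (planeWaveMode L 0) (modeAn L (planeWaveMode L 0) Φ.ψ)) ≠ ⊤ :=
    normSq_ne_top L (isCore_modeAn hL 0 (isCore_modeAn hL 0 hΨ)).contDiff.continuous
  have hN : ((m + 1 + 2 : ℕ) : ℝ≥0∞) ^ 2 * normSq L (modeAn L (planeWaveMode L (-k)) Φ.ψ) ≠ ⊤ :=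
    ENNReal.mul_ne_top (ENNReal.pow_ne_top (ENNReal.natCast_ne_top _)) hvt
  refine ENNReal.ofReal_le_of_le_toReal ?_
  rw [ENNReal.toReal_add (ENNReal.mul_ne_top ENNReal.ofReal_ne_top hut)
      (ENNReal.mul_ne_top ENNReal.ofReal_ne_top (ENNReal.add_ne_top.2 ⟨hN, hΦ₀t⟩)),
    ENNReal.toReal_mul, ENNReal.toReal_mul, ENNReal.toReal_add hN hΦ₀t, ENNReal.toReal_mul, ENNReal.toReal_pow,
    ENNReal.toReal_natCast, ENNReal.toReal_ofReal hε.le, ENNReal.toReal_ofReal (by positivity)]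
  exact crossTerm_real_le hL hε w k hΨ

end Summit.AtomisticToContinuum.BoseEinsteinCondensation.Cruxes.RichardsonAnchorBEC.Birth

end
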